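import Summits.QuantumAdvantage.QuantumAdvantage.Theorems.ResponseDialB

/-! # ResponseDialC — part 3/5 (mechanical split for landing of `ResponseDial`; content verbatim; scopes re-opened with their variables) -/

set_option linter.dupNamespace false
noncomputable section
open scoped Classical

namespace Summit.QuantumAdvantage.QuantumAdvantage.Theorems.ResponseDial
open Finset
open Literature.Computability.QuantumComplexity Literature.Computability.QuantumComplexity.RingHLF
open Literature.Computability.MetaComplexity Literature.Computability.MetaComplexity.Smolensky
open Summit.QuantumAdvantage.AdviceFreeQNC0
open Summit.QuantumAdvantage.QuantumAdvantage.Theorems.AnchorDial (outB dev cN orbF orbL orbL_cons fz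
  cN_orbF_cast oddZeros_orbF win_iff gCond_iff_cN card_filter_orbF orbF_false flip2 card_odd_ge loss_shape_mono)
open Summit.QuantumAdvantage.QuantumAdvantage.Theorems.AnchorDial.Core (ct sg)
open Summit.QuantumAdvantage.QuantumAdvantage.Theorems.HolonomyDial (gCond tPoly tPoly_apply tPoly_mem card_odd_le
  xorP xorP_mem xorP_apply_bool mono_singleton_apply indP indP_mem indP_apply)
open Summit.QuantumAdvantage.QuantumAdvantage.Theorems.StabilizerDial (apIdx apStrat apStrat_mem bitP bitP_apStrat
  pad rel_pad_iff outB_pad_zero pad_mem StabFew rowMask bitP_pad mem_dev_pad_apStrat_iff BlockRec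
  blockSelect_of_fewLocus goodBound_of_blockRec fibreIdentityAt_of_block oddSliceBound_holds eventually_polylog
  side_bounds)
open Summit.QuantumAdvantage.QuantumAdvantage.Theorems.LocusDial (Coverable FewLocus)
open Summit.QuantumAdvantage.QuantumAdvantage.Theorems.SparsityDial (real_loss_of_frac AntipodalLoss3 stabFew_mono_mr
  one_le_logpow)
open Summit.QuantumAdvantage.QuantumAdvantage.Theses.SparsityDial (DenseGenericLoss3)

/-! ## §6  The RESPONSE DIAL: the two pieces, the proved half, `closes`, exactness.

Dial phrase: **additivity of the deviation field's response along adjacent-pair-flip orbits** (after the cheap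
stabilizer gauge, a.e.).  Structured half `AddLoss3` = cheaply additivizable strategies — DECIDED (a theorem, below).
Residual `NonAddGenericLoss3` = `DenseGenericLoss3` restricted to strategies NO cheap gauge makes additively responding. -/

section Dial
variable {N : ℕ}

/-- admissible site 5-tuples: pairwise separated adjacent-pair sites inside `[0, N − 3]`. -/
def Sites (N : ℕ) (b : Fin 5 → ℕ) : Prop := (∀ i j : Fin 5, i < j → b i + 2 ≤ b j) ∧ ∀ i, b i + 3 ≤ N

/-- **CHEAPLY ADDITIVIZABLE at level `e`**: some stabilizer gauge `s` of degree `≤ (log₂ N)^e` and some admissible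
site tuple make the padded strategy respond ADDITIVELY (`AddResp`: flipping the pairs `ε` toggles the deviation status
of `k` iff `k` lies in an odd number of the response sets `R_i`, `i ∈ ε`) along the 32-point orbit of almost every odd
input (a.e. = the lineage's `log₂ N · #bad ≤ 2^(N-1)`).  Gauge-saturated by construction (as `StabFew`). -/
def StabAdd (e : ℕ) (P : Fin N → CubeFn (ZMod 3) N) : Prop :=
  ∃ s : Fin N → CubeFn (ZMod 3) N, (∀ i, s i ∈ lowDeg (ZMod 3) N ((Nat.log 2 N) ^ e)) ∧
    ∃ b : Fin 5 → ℕ, Sites N b ∧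
      Nat.log 2 N * (univ.filter fun x : Fin N → Bool =>
        OddZeros x ∧ ¬ ∃ R : Fin 5 → Finset (Fin N), AddResp b (pad P s) R x).card ≤ 2 ^ (N - 1)

/-- **piece A — the STRUCTURED half** (a THEOREM: `addLoss3`): every low-degree strategy that is cheaply additivizable
loses at least the fraction `n⁻¹` (in fact `1/64`) of the odd class.  Stated WITHOUT the density hypothesis: it holds for
sparse and dense strategies alike. -/
def AddLoss3 : Prop :=
  ∃ C : ℕ, ∀ c : ℕ, ∃ n₀ : ℕ, ∀ n ≥ n₀, ∀ P : Fin n → CubeFn (ZMod 3) n,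
    (∀ i, P i ∈ lowDeg (ZMod 3) n ((Nat.log 2 n) ^ c)) → StabAdd (c + 1) P →
      ((univ.filter fun x : Fin n → Bool => OddZeros x ∧ Rel x (fun i => decide (P i x = 1))).card : ℝ)
        ≤ (1 - 1 / (n : ℝ) ^ C) * (2 : ℝ) ^ (n - 1)

/-- **piece B — the RESIDUAL** `NonAddGenericLoss3`: `DenseGenericLoss3` (not cheaply polylog-sparsifiable low-degree
strategies lose a polynomial fraction) restricted to strategies that are NOT cheaply additivizable at the same level. -/
def NonAddGenericLoss3 : Prop :=
  ∃ a : ℕ, ∃ C : ℕ, ∀ c : ℕ, ∃ n₀ : ℕ, ∀ n ≥ n₀, ∀ P : Fin n → CubeFn (ZMod 3) n,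
    (∀ i, P i ∈ lowDeg (ZMod 3) n ((Nat.log 2 n) ^ c)) →
      ¬ StabFew ((Nat.log 2 n) ^ a) 0 (c + 1) P → ¬ StabAdd (c + 1) P →
        ((univ.filter fun x : Fin n → Bool => OddZeros x ∧ Rel x (fun i => decide (P i x = 1))).card : ℝ)
          ≤ (1 - 1 / (n : ℝ) ^ C) * (2 : ℝ) ^ (n - 1)

/-- **THE STRUCTURED HALF IS A THEOREM.**  Proof: the gauge changes no outcome (`rel_pad_iff`); by the
ADDITIVE-RESPONSE ORBIT LAW (`additive_loss_count`) the additively responding odd inputs number at most `32 ×` the odd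
losers; the non-additively responding ones are at most `2^(n-1)/log₂ n ≤ #odd/2`; hence `#odd ≤ 64·#losers`. -/
theorem addLoss3 : AddLoss3 := by
  refine ⟨1, fun c => ⟨64, fun n hn P hP hadd => ?_⟩⟩
  obtain ⟨s, hs, b, ⟨hb, hbN⟩, hae⟩ := hadd
  have hL : 2 ≤ Nat.log 2 n := Nat.le_log_of_pow_le (by norm_num) (by norm_num; omega)
  have hlaw := additive_loss_count (N := n) (by omega) hb hbN (pad P s)
  have hlos : (univ.filter fun x : Fin n → Bool => OddZeros x ∧ ¬ Rel x (outB (pad P s) x)) =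
      univ.filter fun x : Fin n → Bool => OddZeros x ∧ ¬ Rel x (outB P x) :=
    filter_congr fun x _ => by rw [rel_pad_iff]
  rw [hlos] at hlaw
  have hsplit := Finset.card_filter_add_card_filter_not
    (s := univ.filter fun x : Fin n → Bool => OddZeros x)
    (fun x : Fin n → Bool => ∃ R : Fin 5 → Finset (Fin n), AddResp b (pad P s) R x)
  rw [filter_filter, filter_filter] at hsplit
  have hge : 2 ^ (n - 1) ≤ (univ.filter fun x : Fin n → Bool => OddZeros x).card := card_odd_ge (by omega)
  have hmul := Nat.mul_le_mul_right
    (univ.filter fun x : Fin n → Bool =>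
      OddZeros x ∧ ¬ ∃ R : Fin 5 → Finset (Fin n), AddResp b (pad P s) R x).card hL
  exact real_loss_of_frac (M := 64) (by norm_num) hn (by omega) P (by omega)

/-- **`closes`** — the node's deciding theorem: the two pieces give the residual target `DenseGenericLoss3` BY NAME
(case split on `StabAdd (c+1) P`; exponents and thresholds merged by `max`). -/
theorem closes (hA : AddLoss3) (hB : NonAddGenericLoss3) : DenseGenericLoss3 := by
  obtain ⟨C₁, h₁⟩ := hA
  obtain ⟨a, C₂, h₂⟩ := hB
  refine ⟨a, max C₁ C₂, fun c => ?_⟩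
  obtain ⟨n₁, hn₁⟩ := h₁ c
  obtain ⟨n₂, hn₂⟩ := h₂ c
  refine ⟨max (max n₁ n₂) 1, fun n hn P hP hgen => ?_⟩
  have hn1 : 1 ≤ n := le_trans (le_max_right _ _) hn
  by_cases hadd : StabAdd (c + 1) P
  · exact loss_shape_mono hn1 (le_max_left _ _) _ _ (by positivity)
      (hn₁ n (le_trans (le_trans (le_max_left _ _) (le_max_left _ _)) hn) P hP hadd)
  · exact loss_shape_mono hn1 (le_max_right _ _) _ _ (by positivity)
      (hn₂ n (le_trans (le_trans (le_max_right _ _) (le_max_left _ _)) hn) P hP hgen hadd)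

/-- since piece A is a theorem, the residual ALONE gives the target … -/
theorem dense_of_nonAdd (hB : NonAddGenericLoss3) : DenseGenericLoss3 := closes addLoss3 hB

/-- … and conversely (drop the extra hypothesis): the node is EXACT, -/
theorem nonAdd_of_dense (hD : DenseGenericLoss3) : NonAddGenericLoss3 := by
  obtain ⟨a, C, h⟩ := hD
  exact ⟨a, C, fun c => by
    obtain ⟨n₀, hn₀⟩ := h c
    exact ⟨n₀, fun n hn P hP hgen _ => hn₀ n hn P hP hgen⟩⟩

/-- so `D ⟺ NonAddGenericLoss3` OUTRIGHT (a LAW node: the structured half is decided, the residual is re-typed). -/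
theorem nonAdd_iff_dense : NonAddGenericLoss3 ↔ DenseGenericLoss3 := ⟨dense_of_nonAdd, nonAdd_of_dense⟩

end Dial



end Summit.QuantumAdvantage.QuantumAdvantage.Theorems.ResponseDial
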